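import Mathlib
import Literature.Computability.Complexity.RangeAvoidance

/-!
# Route Nc03AvoidResidualCore, item `ResidualCoreReduction` — frame lemmas: sub-instances and relaxation to pure instances

Helper file for `stmt-PneNP-20227`
(`Summit.PneNP.PneNP.Theses.Nc03AvoidResidualCore.ResidualCoreReduction :
CandAvoidLinearFP → LocalAvoidLinearFP 3 ⊤`), the residual-core reduction of `NC⁰₃-AVOID` at linear
stretch to its pure-`CAND` core (cell pnp-ideate, dossier HOME/pnp-ideate-p2/ROUND-3.md §2.2).

Two elementary principles on which the reduction rests (both [folklore]; ROUND-3 §2.2 (i), (ii)):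

* **Sub-instance principle** (`restrict`, `not_mem_range_of_restrict`): if a string avoids the range
  of the sub-instance formed by some of the outputs, every extension of it avoids the range of the
  whole instance (the projection of the range is contained in the range of the projection).
* **Relaxation to a pure instance** (`relax`, `not_mem_range_of_relax`): replace the `n` inputs by
  `6n` COPIES indexed by (variable, argument role, sign); an output whose truth table is
  `u ↦ b ⊕ P (r ↦ σ r ⊕ u (π r))` (an NPN-normal form with representative `P`, role permutation `π`,
  input-negation mask `σ`, output negation `b`) becomes the PURE `P`-output reading, in role `r`, the
  copy `(vars (π r), r, σ r)`. Every assignment `x` of the original lifts to the assignment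
  `(v, r, s) ↦ x v ⊕ s` of the copies reproducing all outputs up to the known output negations, so
  the range only grows: a point outside the range of the relaxed instance, with the output negations
  put back, is outside the range of the original. The relaxed instance is pure (`IsPure P`): one
  table, and the three copies read by an output are distinct because their roles are.

Nothing here is specific to `P ≠ NP`; these are bookkeeping lemmas for a range-avoidance reduction.
-/

set_option linter.dupNamespace false -- `Summit.PneNP.PneNP.…`: summit = sub-problem name (D-0017 single-conjunct layout)

namespace Summit.PneNP.PneNP.Theorems.Nc03Reduction

open Literature.Computability.Complexity

variable {k n m m' : ℕ}

/-! ## Sub-instances -/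

/-- The sub-instance of `I` formed by the outputs `ι 0, …, ι (m'-1)` (in this order). [folklore] -/
def restrict (I : LocalMap k n m) (ι : Fin m' → Fin m) : LocalMap k n m' where
  vars := fun j => I.vars (ι j)
  table := fun j => I.table (ι j)

/-- The sub-instance computes the corresponding coordinates of the instance. [folklore] -/
@[simp] theorem restrict_eval (I : LocalMap k n m) (ι : Fin m' → Fin m) (x : Fin n → Bool)
    (j : Fin m') : (restrict I ι).eval x j = I.eval x (ι j) := rfl

/-- **Sub-instance principle**: a string whose restriction to the chosen outputs avoids the range of
the sub-instance avoids the range of the instance. (ROUND-3 §2.2 (i).) [folklore] -/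
theorem not_mem_range_of_restrict (I : LocalMap k n m) (ι : Fin m' → Fin m) {y : Fin m → Bool}
    (h : (fun j => y (ι j)) ∉ (restrict I ι).range) : y ∉ I.range := by
  rintro ⟨x, rfl⟩
  exact h ⟨x, funext fun j => rfl⟩

/-! ## Copies of the inputs indexed by (variable, role, sign) -/

/-- The index of the copy `(v, r, s)` among `6n` copies: `6v + 2r + s`. [folklore] -/
def cp (v : Fin n) (r : Fin 3) (s : Bool) : Fin (6 * n) :=
  ⟨6 * v.val + (2 * r.val + (if s then 1 else 0)), by
    have hv := v.isLt; have hr := r.isLt; split <;> omega⟩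

/-- The value of `cp`. [folklore] -/
theorem cp_val (v : Fin n) (r : Fin 3) (s : Bool) :
    (cp v r s).val = 6 * v.val + (2 * r.val + (if s then 1 else 0)) := rfl

/-- Copies with different roles are different. [folklore] -/
theorem cp_injective_role (v v' : Fin n) (s s' : Bool) {r r' : Fin 3}
    (h : cp v r s = cp v' r' s') : r = r' := by
  have h' := congrArg Fin.val h
  simp only [cp_val] at h'
  apply Fin.ext
  have hr := r.isLt; have hr' := r'.isLt
  split at h' <;> split at h' <;> omega

/-- The lift of an assignment `x` of the `n` inputs to the `6n` copies: copy `(v, r, s)` carries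
`x v ⊕ s`. [folklore] -/
def lift (x : Fin n → Bool) : Fin (6 * n) → Bool :=
  fun w => xor (x ⟨w.val / 6, by have := w.isLt; omega⟩) (decide (w.val % 2 = 1))

/-- The lift evaluated at a copy. [folklore] -/
@[simp] theorem lift_cp (x : Fin n → Bool) (v : Fin n) (r : Fin 3) (s : Bool) :
    lift x (cp v r s) = xor (x v) s := by
  unfold lift
  have hr := r.isLt
  have h1 : (cp v r s).val / 6 = v.val := by
    rw [cp_val]; split <;> omega
  have h2 : decide ((cp v r s).val % 2 = 1) = s := by
    rw [cp_val]; cases s <;> simp <;> omega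
  rw [h2]
  congr 2
  exact Fin.ext h1

/-! ## Relaxation to a pure instance -/

/-- The relaxed instance: output `j` applies the representative `P` and reads, in role `r`, the copy
`(vars j (π j r), r, σ j r)`. [folklore] -/
def relax (I : LocalMap 3 n m) (π : Fin m → Fin 3 → Fin 3) (σ : Fin m → Fin 3 → Bool)
    (P : (Fin 3 → Bool) → Bool) : LocalMap 3 (6 * n) m where
  vars := fun j r => cp (I.vars j (π j r)) r (σ j r)
  table := fun _ => P

/-- The relaxed instance is a pure `P`-instance. [folklore] -/
theorem relax_isPure (I : LocalMap 3 n m) (π : Fin m → Fin 3 → Fin 3) (σ : Fin m → Fin 3 → Bool)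
    (P : (Fin 3 → Bool) → Bool) : (relax I π σ P).IsPure P :=
  ⟨fun _ => rfl, fun _ _ _ h => cp_injective_role _ _ _ _ h⟩

/-- The relaxed instance on the lifted assignment. [folklore] -/
@[simp] theorem relax_eval_lift (I : LocalMap 3 n m) (π : Fin m → Fin 3 → Fin 3)
    (σ : Fin m → Fin 3 → Bool) (P : (Fin 3 → Bool) → Bool) (x : Fin n → Bool) (j : Fin m) :
    (relax I π σ P).eval (lift x) j = P (fun r => xor (x (I.vars j (π j r))) (σ j r)) := by
  simp [relax, LocalMap.eval]

/-- **Relaxation principle**: if every output of `I` is in the NPN-normal form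
`u ↦ b j ⊕ P (r ↦ u (π j r) ⊕ σ j r)`, then a point `y'` outside the range of the relaxed pure
instance yields the point `j ↦ y' j ⊕ b j` outside the range of `I`. (ROUND-3 §2.2 (ii).)
[folklore] -/
theorem not_mem_range_of_relax (I : LocalMap 3 n m) (π : Fin m → Fin 3 → Fin 3)
    (σ : Fin m → Fin 3 → Bool) (b : Fin m → Bool) (P : (Fin 3 → Bool) → Bool)
    (hT : ∀ j u, I.table j u = xor (P (fun r => xor (u (π j r)) (σ j r))) (b j))
    {y' : Fin m → Bool} (hy' : y' ∉ (relax I π σ P).range) :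
    (fun j => xor (y' j) (b j)) ∉ I.range := by
  rintro ⟨x, hx⟩
  apply hy'
  refine ⟨lift x, funext fun j => ?_⟩
  have hj := congrFun hx j
  simp only [LocalMap.eval] at hj
  rw [hT] at hj
  rw [relax_eval_lift]
  -- `hj : P (...) ⊕ b j = y' j ⊕ b j`
  have := congrArg (fun t => xor t (b j)) hj
  simpa using this

/-- The two principles combined: a bucket `ι` of outputs all in the NPN-normal form of one
representative `P`; a point outside the range of the relaxed bucket, output negations put back and
extended by `false` elsewhere, avoids the range of `I`. [folklore] -/
theorem not_mem_range_of_bucket (I : LocalMap 3 n m) (ι : Fin m' → Fin m) (hι : Function.Injective ι)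
    (π : Fin m' → Fin 3 → Fin 3) (σ : Fin m' → Fin 3 → Bool) (b : Fin m' → Bool)
    (P : (Fin 3 → Bool) → Bool)
    (hT : ∀ j u, I.table (ι j) u = xor (P (fun r => xor (u (π j r)) (σ j r))) (b j))
    {y' : Fin m' → Bool} (hy' : y' ∉ (relax (restrict I ι) π σ P).range)
    (y : Fin m → Bool) (hy : ∀ j, y (ι j) = xor (y' j) (b j)) : y ∉ I.range := by
  have _ := hι
  refine not_mem_range_of_restrict I ι ?_
  have h := not_mem_range_of_relax (restrict I ι) π σ b P hT hy'
  have e : (fun j => y (ι j)) = fun j => xor (y' j) (b j) := funext hy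
  rw [e]
  exact h

end Summit.PneNP.PneNP.Theorems.Nc03Reduction
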